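import Mathlib
import Literature.Computability.AlgebraicComplexity.StandardFamiliesProofs
import Summits.ValiantsHypothesis.ValiantsHypothesis.Theorems.DivisionGapPerCofactorDegreeReductionStubTwoTowerCollapse

/-!
# Crux `DivisionGap.PerCofactorDegreeReduction` (stmt-ValiantsHypothesis-15046), line `Sketch` —
# stub `stub_relationIdealRealParts`: complex relations modulo the permanent come from real ones

**Theorem (`stub_relationIdealRealParts`).** Let `ℓ₁, …, ℓ_r ∈ ℝ[x_ij]` (`n × n` variables) and
let `G ∈ ℂ[y₁, …, y_r]`.  If `per_n ∣ G(ℓ₁, …, ℓ_r)` over `ℂ`, then `per_n ∣ (Re G)(ℓ)` and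
`per_n ∣ (Im G)(ℓ)` over `ℝ`, where `Re G`, `Im G ∈ ℝ[y]` are obtained from `G` by taking real,
resp. imaginary, parts of all coefficients.

## Proof

Real and imaginary parts of coefficients are Mathlib's `AddMonoidAlgebra.map` of
`Complex.reAddGroupHom` / `Complex.imAddGroupHom`; both are `ℝ`-linear maps `λ : ℂ → ℝ`.
* *Coefficientwise parts commute with evaluation at real polynomials* (`mapRange_aeval_map`):
  `λ(G(ℓ_ℂ)) = (λ G)(ℓ)`, by induction on `G` (`MvPolynomial.induction_on`): constants
  (`mapRange_C`), additivity (`AddMonoidAlgebra.map_add`), and multiplication by a variable, which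
  is multiplication by the REAL polynomial `ℓᵢ` after evaluation
  (`TwoTowerCollapse.mapRange_map_mul`: `λ(q s) = q λ(s)` for real `q`).
* Write `G(ℓ_ℂ) = per_n · Q` over `ℂ`; since `per_n` is real (`map_perPoly`),
  `(λ G)(ℓ) = λ(G(ℓ_ℂ)) = λ(per_n · Q) = per_n · λ(Q)` (`mapRange_map_mul` again), so
  `per_n ∣ (λ G)(ℓ)` over `ℝ` for `λ = Re, Im`.
No hypothesis `1 ≤ n` is needed.  Leans on the tree only: `TwoTowerCollapse.coeff_mapRange`,
`TwoTowerCollapse.mapRange_map_mul`, `map_perPoly`; Mathlib.  No definitions.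
-/

noncomputable section

-- `Summit.ValiantsHypothesis.ValiantsHypothesis.…` is the tree's mandated single-conjunct layout
-- (Problem = Summit), so the duplicated namespace component is intended.
set_option linter.dupNamespace false

namespace Summit.ValiantsHypothesis.ValiantsHypothesis.Theorems.DivisionGap.PerCofactorDegreeReduction.RelationIdealRealParts

open MvPolynomial Literature.Computability.AlgebraicComplexity
open Summit.ValiantsHypothesis.ValiantsHypothesis.Theorems.DivisionGap.PerCofactorDegreeReduction.TwoTowerCollapse
  (coeff_mapRange mapRange_map_mul)

/-! ### Coefficientwise real/imaginary parts commute with evaluation at real polynomials -/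

section Parts

variable {σ τ : Type*}

/-- The coefficientwise image of a constant is the constant: `λ(C a) = C (λ a)`. [folklore] -/
theorem mapRange_C (ℓR : ℂ →+ ℝ) (a : ℂ) :
    (AddMonoidAlgebra.map ℓR (C a : MvPolynomial σ ℂ) : MvPolynomial σ ℝ) = C (ℓR a) := by
  classical
  ext m
  simp only [coeff_mapRange, coeff_C]
  split_ifs
  · rfl
  · exact map_zero ℓR

/-- Multiplication by a variable commutes with an `ℝ`-linear coefficient map:
`λ(s · yᵢ) = λ(s) · yᵢ`. [folklore] -/
theorem mapRange_mul_X (ℓR : ℂ →+ ℝ) (hℓ : ∀ (a : ℝ) (z : ℂ), ℓR (a * z) = a * ℓR z)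
    (s : MvPolynomial σ ℂ) (i : σ) :
    (AddMonoidAlgebra.map ℓR (s * X i) : MvPolynomial σ ℝ) = AddMonoidAlgebra.map ℓR s * X i := by
  have hX : (X i : MvPolynomial σ ℂ) = map Complex.ofRealHom (X i) := (map_X _ _).symm
  rw [mul_comm, hX, mapRange_map_mul ℓR hℓ, mul_comm]

/-- **Coefficientwise parts commute with evaluation at real polynomials.** For an `ℝ`-linear
`λ : ℂ → ℝ`, real polynomials `fᵢ` and a complex polynomial `G`:
`λ(G(f_ℂ)) = (λ G)(f)`, where `f_ℂ` denotes the complexifications. Proof by induction on `G`: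
constants, additivity, and multiplication by a variable (which after evaluation is multiplication
by a real polynomial, `TwoTowerCollapse.mapRange_map_mul`). [folklore] -/
theorem mapRange_aeval_map (ℓR : ℂ →+ ℝ) (hℓ : ∀ (a : ℝ) (z : ℂ), ℓR (a * z) = a * ℓR z)
    (f : σ → MvPolynomial τ ℝ) (G : MvPolynomial σ ℂ) :
    (AddMonoidAlgebra.map ℓR (aeval (fun i => map Complex.ofRealHom (f i)) G) :
        MvPolynomial τ ℝ) =
      aeval f (AddMonoidAlgebra.map ℓR G : MvPolynomial σ ℝ) := by
  induction G using MvPolynomial.induction_on with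
  | C a =>
    rw [aeval_C, algebraMap_eq, mapRange_C, mapRange_C, aeval_C, algebraMap_eq]
  | add p q hp hq =>
    rw [map_add, AddMonoidAlgebra.map_add, AddMonoidAlgebra.map_add, map_add, hp, hq]
  | mul_X p i hp =>
    rw [map_mul, aeval_X, mul_comm, mapRange_map_mul ℓR hℓ, hp, mapRange_mul_X ℓR hℓ, map_mul,
      aeval_X, mul_comm]

end Parts

/-! ### The theorem -/

/-- **stub_relationIdealRealParts — COMPLEX RELATIONS modulo the permanent COME FROM REAL ONES.**
For real polynomials `ℓ₁, …, ℓ_r` in the `n × n` variables and `G ∈ ℂ[y₁, …, y_r]` with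
`per_n ∣ G(ℓ)` over `ℂ`, the coefficientwise real and imaginary parts `Re G`, `Im G ∈ ℝ[y]` satisfy
`per_n ∣ (Re G)(ℓ)` and `per_n ∣ (Im G)(ℓ)` over `ℝ`.  Proof: write `G(ℓ_ℂ) = per_n · Q`; taking
parts coefficientwise commutes with evaluation at the real `ℓ` (`mapRange_aeval_map`) and with
multiplication by the real `per_n` (`TwoTowerCollapse.mapRange_map_mul`, `map_perPoly`), so
`(Re G)(ℓ) = per_n · Re Q` and `(Im G)(ℓ) = per_n · Im Q`. [folklore] -/
theorem stub_relationIdealRealParts (n r : ℕ) (ℓ : Fin r → MvPolynomial (Fin n × Fin n) ℝ)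
    (G : MvPolynomial (Fin r) ℂ)
    (h : perPoly (Fin n) ℂ ∣
      MvPolynomial.aeval (fun i => MvPolynomial.map Complex.ofRealHom (ℓ i)) G) :
    perPoly (Fin n) ℝ ∣ MvPolynomial.aeval ℓ
        (AddMonoidAlgebra.map Complex.reAddGroupHom G : MvPolynomial (Fin r) ℝ) ∧
    perPoly (Fin n) ℝ ∣ MvPolynomial.aeval ℓ
        (AddMonoidAlgebra.map Complex.imAddGroupHom G : MvPolynomial (Fin r) ℝ) := by
  obtain ⟨Q, hQ⟩ := h
  have key : ∀ ℓR : ℂ →+ ℝ, (∀ (a : ℝ) (z : ℂ), ℓR (a * z) = a * ℓR z) →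
      perPoly (Fin n) ℝ ∣ aeval ℓ (AddMonoidAlgebra.map ℓR G : MvPolynomial (Fin r) ℝ) := by
    intro ℓR hℓ
    refine ⟨AddMonoidAlgebra.map ℓR Q, ?_⟩
    rw [← mapRange_aeval_map ℓR hℓ, hQ, ← map_perPoly (n := Fin n) (k := ℝ) Complex.ofRealHom,
      mapRange_map_mul ℓR hℓ]
  exact ⟨key _ fun a z => by simp, key _ fun a z => by simp⟩

end Summit.ValiantsHypothesis.ValiantsHypothesis.Theorems.DivisionGap.PerCofactorDegreeReduction.RelationIdealRealParts

end
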